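import Summits.NavierStokesRegularity.FluidComputer.DihedralSectorSharp
import Summits.NavierStokesRegularity.FluidComputer.SublatticeSupport
import HarnessLib

/-!
# Forced modes of the symmetric column, I: the off-plane witness families

HONEST FRAMING (cell `pub-fluidc`, verbatim): *low prior, high value-of-information experiment on Tao's
machine paradigm; NOT a claim that NS blows up.* Nothing here concerns the Navier–Stokes PDE beyond the
Galerkin-truncated ODE system both engines of the cell integrate.

Companion of `SublatticeSupport` (pub-fluidc-lit, p213261), `DihedralSector` (p214574), `DihedralSectorWitness`
(p214776) and `DihedralSectorSharp` (GADGETS gen 47, p214969), which prove that a real incompressible Fourier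
coefficient field on `ℤ³` fixed by the symmetry group of the cell's Hou–Luo-type gadget data — the vertical
translation by one period `T = translate (vertical (2π/m))`, the glide reflections `G_a = reflX.sg (vertical a)`,
`S_a = reflZ.sg (vertical a)` and the quarter turn `R = rotZ.act` — vanishes off the sublattice `{m ∣ k₂}`, on
the vertical axis and on the four mirror lines of the `z`-mean plane, and that nothing else is forced in that
plane. This file and `ForcedModes` (part II, the classification) settle the OFF-PLANE sublattice modes
`m ∣ k₂ ≠ 0` for every glide offset `a = nπ/m` (`n : ℤ`; the data of record use the half period, `n` odd):

* `chi c N` — the cut-off `k₂ · 1_K` of the finite `D₄ₕ`-invariant set `K(c, N) = {k : k₂² = c, k₀² + k₁² = N}`;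
* `phase_glide_of_even` / `phase_glide_of_odd` — on `K((m j)², N)` the glide phase `e^{−i k₂ a}` is `(−1)^{n j}`;
* `swirlW c N` — the SWIRL field `k₂ · (−k₁, k₀, 0)` (real; reversed by the plain reflections `x ↦ −x`, `z ↦ −z`,
  hence fixed by the glides exactly where their phase is `−1`), and `polW c N` — the POLOIDAL field
  `i k₂ · (−k₀ k₂, −k₁ k₂, k₀² + k₁²)` (fixed by the plain reflections, hence by the glides where the phase is
  `+1`); both incompressible, fixed by the quarter turn and by `T` when `c = (m j)²`, and non-zero at every
  `k ∈ K(k₂², k₀² + k₁²)` off the axis and off the plane (`swirlW_coeff_ne_zero`, `polW_coeff_ne_zero`).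

0 sorry, 0 named facts (D-0026). [folklore]
-/

noncomputable section

namespace Summit.NavierStokesRegularity.FluidComputer.ForcedModes

open Literature.Analysis.FluidPDE.FluidComputer
open Literature.Analysis.FluidPDE.FluidComputer.ShellTransfer
open Complex

/-! ## The cut-off `χ`: `k₂` on the finite invariant set `K(c, N)`, zero elsewhere -/

/-- `χ_{c,N}(k) = k₂` if `k₂² = c` and `k₀² + k₁² = N`, else `0`. [folklore] -/
def chi (c N : ℤ) (k : Fin 3 → ℤ) : ℤ := if k 2 ^ 2 = c ∧ k 0 ^ 2 + k 1 ^ 2 = N then k 2 else 0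

/-- `χ` on the set `K(c, N)`. [folklore] -/
theorem chi_of_mem {c N : ℤ} {k : Fin 3 → ℤ} (h : k 2 ^ 2 = c ∧ k 0 ^ 2 + k 1 ^ 2 = N) : chi c N k = k 2 :=
  if_pos h

/-- `χ` off the set `K(c, N)`. [folklore] -/
theorem chi_of_not_mem {c N : ℤ} {k : Fin 3 → ℤ} (h : ¬ (k 2 ^ 2 = c ∧ k 0 ^ 2 + k 1 ^ 2 = N)) :
    chi c N k = 0 :=
  if_neg h

/-- `χ(-k) = -χ(k)`. [folklore] -/
theorem chi_neg (c N : ℤ) (k : Fin 3 → ℤ) : chi c N (-k) = -chi c N k := by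
  by_cases h : k 2 ^ 2 = c ∧ k 0 ^ 2 + k 1 ^ 2 = N
  · have h' : (-k) 2 ^ 2 = c ∧ (-k) 0 ^ 2 + (-k) 1 ^ 2 = N := by
      simpa only [Pi.neg_apply, neg_sq] using h
    rw [chi_of_mem h, chi_of_mem h', Pi.neg_apply]
  · have h' : ¬ ((-k) 2 ^ 2 = c ∧ (-k) 0 ^ 2 + (-k) 1 ^ 2 = N) := by
      simpa only [Pi.neg_apply, neg_sq] using h
    rw [chi_of_not_mem h, chi_of_not_mem h', neg_zero]

/-- `χ(-k₀, k₁, k₂) = χ(k)`. [folklore] -/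
theorem chi_reflX (c N : ℤ) (k : Fin 3 → ℤ) : chi c N ![-k 0, k 1, k 2] = chi c N k := by
  by_cases h : k 2 ^ 2 = c ∧ k 0 ^ 2 + k 1 ^ 2 = N
  · have h' : (![-k 0, k 1, k 2] : Fin 3 → ℤ) 2 ^ 2 = c ∧
        (![-k 0, k 1, k 2] : Fin 3 → ℤ) 0 ^ 2 + (![-k 0, k 1, k 2] : Fin 3 → ℤ) 1 ^ 2 = N := by
      refine ⟨by simpa using h.1, ?_⟩
      simp only [Matrix.cons_val_zero, Matrix.cons_val_one, neg_sq]; exact h.2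
    rw [chi_of_mem h, chi_of_mem h']
    simp
  · have h' : ¬ ((![-k 0, k 1, k 2] : Fin 3 → ℤ) 2 ^ 2 = c ∧
        (![-k 0, k 1, k 2] : Fin 3 → ℤ) 0 ^ 2 + (![-k 0, k 1, k 2] : Fin 3 → ℤ) 1 ^ 2 = N) := by
      rintro ⟨h2, hN⟩
      refine h ⟨by simpa using h2, ?_⟩
      simpa only [Matrix.cons_val_zero, Matrix.cons_val_one, Matrix.head_cons, neg_sq] using hN
    rw [chi_of_not_mem h, chi_of_not_mem h']

/-- `χ(k₁, -k₀, k₂) = χ(k)`. [folklore] -/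
theorem chi_rotZ (c N : ℤ) (k : Fin 3 → ℤ) : chi c N ![k 1, -k 0, k 2] = chi c N k := by
  by_cases h : k 2 ^ 2 = c ∧ k 0 ^ 2 + k 1 ^ 2 = N
  · have h' : (![k 1, -k 0, k 2] : Fin 3 → ℤ) 2 ^ 2 = c ∧
        (![k 1, -k 0, k 2] : Fin 3 → ℤ) 0 ^ 2 + (![k 1, -k 0, k 2] : Fin 3 → ℤ) 1 ^ 2 = N := by
      refine ⟨by simpa using h.1, ?_⟩
      simp only [Matrix.cons_val_zero, Matrix.cons_val_one, neg_sq]; linarith [h.2]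
    rw [chi_of_mem h, chi_of_mem h']
    simp
  · have h' : ¬ ((![k 1, -k 0, k 2] : Fin 3 → ℤ) 2 ^ 2 = c ∧
        (![k 1, -k 0, k 2] : Fin 3 → ℤ) 0 ^ 2 + (![k 1, -k 0, k 2] : Fin 3 → ℤ) 1 ^ 2 = N) := by
      rintro ⟨h2, hN⟩
      refine h ⟨by simpa using h2, ?_⟩
      simp only [Matrix.cons_val_zero, Matrix.cons_val_one, neg_sq] at hN; linarith
    rw [chi_of_not_mem h, chi_of_not_mem h']

/-- `χ(k₀, k₁, -k₂) = -χ(k)`. [folklore] -/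
theorem chi_reflZ (c N : ℤ) (k : Fin 3 → ℤ) : chi c N ![k 0, k 1, -k 2] = -chi c N k := by
  by_cases h : k 2 ^ 2 = c ∧ k 0 ^ 2 + k 1 ^ 2 = N
  · have h' : (![k 0, k 1, -k 2] : Fin 3 → ℤ) 2 ^ 2 = c ∧
        (![k 0, k 1, -k 2] : Fin 3 → ℤ) 0 ^ 2 + (![k 0, k 1, -k 2] : Fin 3 → ℤ) 1 ^ 2 = N := by
      refine ⟨?_, by simpa using h.2⟩
      simp only [Matrix.cons_val_two, Matrix.tail_cons, Matrix.head_cons, neg_sq]; exact h.1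
    rw [chi_of_mem h, chi_of_mem h']
    simp
  · have h' : ¬ ((![k 0, k 1, -k 2] : Fin 3 → ℤ) 2 ^ 2 = c ∧
        (![k 0, k 1, -k 2] : Fin 3 → ℤ) 0 ^ 2 + (![k 0, k 1, -k 2] : Fin 3 → ℤ) 1 ^ 2 = N) := by
      rintro ⟨h2, hN⟩
      refine h ⟨?_, by simpa using hN⟩
      simpa only [Matrix.cons_val_two, Matrix.tail_cons, Matrix.head_cons, neg_sq] using h2
    rw [chi_of_not_mem h, chi_of_not_mem h', neg_zero]

/-- Off the sublattice `m ∣ k₂` the cut-off `χ_{(mj)², N}` vanishes. [folklore] -/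
theorem chi_eq_zero_of_not_dvd {m : ℕ} {j N : ℤ} {k : Fin 3 → ℤ} (hk : ¬ (m : ℤ) ∣ k 2) :
    chi (((m : ℤ) * j) ^ 2) N k = 0 := by
  refine chi_of_not_mem ?_
  rintro ⟨h2, -⟩
  rcases sq_eq_sq_iff_eq_or_eq_neg.mp h2 with h | h
  · exact hk ⟨j, h⟩
  · exact hk ⟨-j, by rw [h]; ring⟩

/-! ## The glide phase on the sublattice: `e^{-i k₂ nπ/m} = (-1)^{nj}` when `k₂ = ± m j` -/

/-- On `k₂² = (m j)²` the phase of the vertical shift `nπ/m` is that of an integer multiple of `π` with the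
parity of `n j`. [folklore] -/
theorem rdot_glide {m : ℕ} (hm : m ≠ 0) (n j : ℤ) {k : Fin 3 → ℤ} (hk : k 2 ^ 2 = ((m : ℤ) * j) ^ 2) :
    ∃ s : ℤ, (Even s ↔ Even (n * j)) ∧ rdot k (vertical (n * Real.pi / m)) = s * Real.pi := by
  have hmR : (m : ℝ) ≠ 0 := by exact_mod_cast hm
  rw [rdot_vertical]
  rcases sq_eq_sq_iff_eq_or_eq_neg.mp hk with h | h
  · refine ⟨n * j, Iff.rfl, ?_⟩
    rw [h]; push_cast; field_simp
  · refine ⟨-(n * j), even_neg, ?_⟩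
    rw [h]; push_cast; field_simp

/-- … so it is `+1` when `n j` is even … [folklore] -/
theorem phase_glide_of_even {m : ℕ} (hm : m ≠ 0) {n j : ℤ} {k : Fin 3 → ℤ}
    (hk : k 2 ^ 2 = ((m : ℤ) * j) ^ 2) (he : Even (n * j)) : phase (vertical (n * Real.pi / m)) k = 1 := by
  obtain ⟨s, hs, hr⟩ := rdot_glide hm n j hk
  exact phase_eq_one_of_even hr (hs.mpr he)

/-- … and `-1` when `n j` is odd. [folklore] -/
theorem phase_glide_of_odd {m : ℕ} (hm : m ≠ 0) {n j : ℤ} {k : Fin 3 → ℤ}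
    (hk : k 2 ^ 2 = ((m : ℤ) * j) ^ 2) (ho : Odd (n * j)) : phase (vertical (n * Real.pi / m)) k = -1 := by
  obtain ⟨s, hs, hr⟩ := rdot_glide hm n j hk
  refine phase_eq_neg_one_of_odd hr ?_
  rcases Int.even_or_odd s with h | h
  · exact absurd (hs.mp h) (Int.not_even_iff_odd.mpr ho)
  · exact h

/-! ## The swirl witness `k₂ (−k₁, k₀, 0) · 1_K` -/

/-- **The swirl witness**: `û(k) = χ(k) (−k₁, k₀, 0)`, a real horizontal incompressible field. [folklore] -/
def swirlW (c N : ℤ) : FourierVelocity where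
  coeff k := ![-((((k 1 * chi c N k : ℤ)) : ℂ)), (((k 0 * chi c N k : ℤ)) : ℂ), 0]
  reality k i := by
    fin_cases i
    · simp [chi_neg]
    · simp [chi_neg]
    · simp
  divFree k := by
    simp [Fin.sum_univ_three]; ring

/-- `û₀ = -k₁ χ`. [folklore] -/
@[simp] theorem swirlW_coeff_zero (c N : ℤ) (k : Fin 3 → ℤ) :
    (swirlW c N).coeff k 0 = -((((k 1 * chi c N k : ℤ)) : ℂ)) := rfl

/-- `û₁ = k₀ χ`. [folklore] -/
@[simp] theorem swirlW_coeff_one (c N : ℤ) (k : Fin 3 → ℤ) :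
    (swirlW c N).coeff k 1 = (((k 0 * chi c N k : ℤ)) : ℂ) := rfl

/-- `û₂ = 0`. [folklore] -/
@[simp] theorem swirlW_coeff_two (c N : ℤ) (k : Fin 3 → ℤ) : (swirlW c N).coeff k 2 = 0 := rfl

/-- The swirl witness is supported on `K(c, N)`. [folklore] -/
theorem swirlW_coeff_eq_zero {c N : ℤ} {k : Fin 3 → ℤ} (h : ¬ (k 2 ^ 2 = c ∧ k 0 ^ 2 + k 1 ^ 2 = N)) :
    (swirlW c N).coeff k = 0 := by
  funext j
  fin_cases j <;> simp [chi_of_not_mem h]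

/-- The plain reflection `x ↦ -x` REVERSES the swirl witness, coefficientwise. [folklore] -/
theorem reflX_act_swirlW_coeff (c N : ℤ) (k : Fin 3 → ℤ) (j : Fin 3) :
    (reflX.act (swirlW c N)).coeff k j = -(swirlW c N).coeff k j := by
  rw [LatticeIsometry.act_coeff, reflX_invK]
  unfold reflX
  fin_cases j <;> simp [Fin.sum_univ_three, chi_reflX]

/-- The plain reflection `z ↦ -z` REVERSES the swirl witness, coefficientwise. [folklore] -/
theorem reflZ_act_swirlW_coeff (c N : ℤ) (k : Fin 3 → ℤ) (j : Fin 3) :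
    (reflZ.act (swirlW c N)).coeff k j = -(swirlW c N).coeff k j := by
  rw [LatticeIsometry.act_coeff, reflZ_invK]
  unfold reflZ
  fin_cases j <;> simp [Fin.sum_univ_three, chi_reflZ]

/-- The quarter turn fixes the swirl witness. [folklore] -/
theorem rotZ_act_swirlW (c N : ℤ) : rotZ.act (swirlW c N) = swirlW c N := by
  apply TaylorGreenHat.fourierVelocity_ext
  funext k j
  rw [LatticeIsometry.act_coeff, rotZ_invK]
  unfold rotZ
  fin_cases j <;> simp [Fin.sum_univ_three, chi_rotZ]

/-- The one-period vertical translation fixes the swirl witness on the sublattice set `K((mj)², N)`.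
[folklore] -/
theorem translate_period_swirlW {m : ℕ} (hm : m ≠ 0) (j N : ℤ) :
    translate (vertical (2 * Real.pi / m)) (swirlW (((m : ℤ) * j) ^ 2) N) = swirlW (((m : ℤ) * j) ^ 2) N := by
  refine SublatticeSupport.translate_period_eq_self_of_support hm fun k hk => ?_
  funext i
  fin_cases i <;> simp [chi_eq_zero_of_not_dvd hk]

/-- The glide `G_a = T_a ∘ (x ↦ -x)`, `a = nπ/m`, fixes the swirl witness on `K((mj)², N)` when `n j` is odd
(phase `-1` times the reversal). [folklore] -/
theorem reflX_sg_swirlW {m : ℕ} (hm : m ≠ 0) {n j : ℤ} (ho : Odd (n * j)) (N : ℤ) :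
    reflX.sg (vertical (n * Real.pi / m)) (swirlW (((m : ℤ) * j) ^ 2) N) = swirlW (((m : ℤ) * j) ^ 2) N := by
  apply TaylorGreenHat.fourierVelocity_ext
  funext k i
  rw [LatticeIsometry.sg_def, translate_coeff, reflX_act_swirlW_coeff]
  by_cases h : k 2 ^ 2 = ((m : ℤ) * j) ^ 2 ∧ k 0 ^ 2 + k 1 ^ 2 = N
  · rw [phase_glide_of_odd hm h.1 ho]; ring
  · rw [swirlW_coeff_eq_zero h]; simp

/-- The glide `S_a = T_a ∘ (z ↦ -z)`, `a = nπ/m`, fixes the swirl witness on `K((mj)², N)` when `n j` is odd.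
[folklore] -/
theorem reflZ_sg_swirlW {m : ℕ} (hm : m ≠ 0) {n j : ℤ} (ho : Odd (n * j)) (N : ℤ) :
    reflZ.sg (vertical (n * Real.pi / m)) (swirlW (((m : ℤ) * j) ^ 2) N) = swirlW (((m : ℤ) * j) ^ 2) N := by
  apply TaylorGreenHat.fourierVelocity_ext
  funext k i
  rw [LatticeIsometry.sg_def, translate_coeff, reflZ_act_swirlW_coeff]
  by_cases h : k 2 ^ 2 = ((m : ℤ) * j) ^ 2 ∧ k 0 ^ 2 + k 1 ^ 2 = N
  · rw [phase_glide_of_odd hm h.1 ho]; ring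
  · rw [swirlW_coeff_eq_zero h]; simp

/-- **Off the vertical axis and off the `z`-mean plane the swirl witness does not vanish.** [folklore] -/
theorem swirlW_coeff_ne_zero {k : Fin 3 → ℤ} (hk2 : k 2 ≠ 0) (hoff : ¬ (k 0 = 0 ∧ k 1 = 0)) :
    (swirlW (k 2 ^ 2) (k 0 ^ 2 + k 1 ^ 2)).coeff k ≠ 0 := by
  have hχ : chi (k 2 ^ 2) (k 0 ^ 2 + k 1 ^ 2) k = k 2 := chi_of_mem ⟨rfl, rfl⟩
  intro h
  by_cases hk1 : k 1 = 0
  · have hk0 : k 0 ≠ 0 := fun h0 => hoff ⟨h0, hk1⟩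
    have h1 : (swirlW (k 2 ^ 2) (k 0 ^ 2 + k 1 ^ 2)).coeff k 1 = 0 := by rw [h]; rfl
    rw [swirlW_coeff_one, hχ] at h1
    have : k 0 * k 2 = 0 := by exact_mod_cast h1
    exact (mul_ne_zero hk0 hk2) this
  · have h0 : (swirlW (k 2 ^ 2) (k 0 ^ 2 + k 1 ^ 2)).coeff k 0 = 0 := by rw [h]; rfl
    rw [swirlW_coeff_zero, hχ, neg_eq_zero] at h0
    have : k 1 * k 2 = 0 := by exact_mod_cast h0
    exact (mul_ne_zero hk1 hk2) this

/-! ## The poloidal witness `i k₂ (−k₀ k₂, −k₁ k₂, k₀² + k₁²) · 1_K` -/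

/-- **The poloidal witness**: `û(k) = i χ(k) (−k₀ k₂, −k₁ k₂, k₀² + k₁²)`, an incompressible field with purely
imaginary coefficients. [folklore] -/
def polW (c N : ℤ) : FourierVelocity where
  coeff k := ![-(I * (((k 0 * k 2 * chi c N k : ℤ)) : ℂ)), -(I * (((k 1 * k 2 * chi c N k : ℤ)) : ℂ)),
    I * ((((k 0 ^ 2 + k 1 ^ 2) * chi c N k : ℤ)) : ℂ)]
  reality k i := by
    fin_cases i
    · simp [chi_neg]
    · simp [chi_neg]
    · simp [chi_neg]
  divFree k := by
    simp [Fin.sum_univ_three]; ring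

/-- `û₀ = -i k₀ k₂ χ`. [folklore] -/
@[simp] theorem polW_coeff_zero (c N : ℤ) (k : Fin 3 → ℤ) :
    (polW c N).coeff k 0 = -(I * (((k 0 * k 2 * chi c N k : ℤ)) : ℂ)) := rfl

/-- `û₁ = -i k₁ k₂ χ`. [folklore] -/
@[simp] theorem polW_coeff_one (c N : ℤ) (k : Fin 3 → ℤ) :
    (polW c N).coeff k 1 = -(I * (((k 1 * k 2 * chi c N k : ℤ)) : ℂ)) := rfl

/-- `û₂ = i (k₀² + k₁²) χ`. [folklore] -/
@[simp] theorem polW_coeff_two (c N : ℤ) (k : Fin 3 → ℤ) :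
    (polW c N).coeff k 2 = I * ((((k 0 ^ 2 + k 1 ^ 2) * chi c N k : ℤ)) : ℂ) := rfl

/-- The poloidal witness is supported on `K(c, N)`. [folklore] -/
theorem polW_coeff_eq_zero {c N : ℤ} {k : Fin 3 → ℤ} (h : ¬ (k 2 ^ 2 = c ∧ k 0 ^ 2 + k 1 ^ 2 = N)) :
    (polW c N).coeff k = 0 := by
  funext j
  fin_cases j <;> simp [chi_of_not_mem h]

/-- The plain reflection `x ↦ -x` fixes the poloidal witness. [folklore] -/
theorem reflX_act_polW (c N : ℤ) : reflX.act (polW c N) = polW c N := by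
  apply TaylorGreenHat.fourierVelocity_ext
  funext k j
  rw [LatticeIsometry.act_coeff, reflX_invK]
  unfold reflX
  fin_cases j <;> simp [Fin.sum_univ_three, chi_reflX]

/-- The plain reflection `z ↦ -z` fixes the poloidal witness. [folklore] -/
theorem reflZ_act_polW (c N : ℤ) : reflZ.act (polW c N) = polW c N := by
  apply TaylorGreenHat.fourierVelocity_ext
  funext k j
  rw [LatticeIsometry.act_coeff, reflZ_invK]
  unfold reflZ
  fin_cases j <;> simp [Fin.sum_univ_three, chi_reflZ]

/-- The quarter turn fixes the poloidal witness. [folklore] -/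
theorem rotZ_act_polW (c N : ℤ) : rotZ.act (polW c N) = polW c N := by
  apply TaylorGreenHat.fourierVelocity_ext
  funext k j
  rw [LatticeIsometry.act_coeff, rotZ_invK]
  unfold rotZ
  fin_cases j <;> simp [Fin.sum_univ_three, chi_rotZ]
  left; ring

/-- The one-period vertical translation fixes the poloidal witness on `K((mj)², N)`. [folklore] -/
theorem translate_period_polW {m : ℕ} (hm : m ≠ 0) (j N : ℤ) :
    translate (vertical (2 * Real.pi / m)) (polW (((m : ℤ) * j) ^ 2) N) = polW (((m : ℤ) * j) ^ 2) N := by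
  refine SublatticeSupport.translate_period_eq_self_of_support hm fun k hk => ?_
  funext i
  fin_cases i <;> simp [chi_eq_zero_of_not_dvd hk]

/-- The glide `G_a`, `a = nπ/m`, fixes the poloidal witness on `K((mj)², N)` when `n j` is even (phase `+1`).
[folklore] -/
theorem reflX_sg_polW {m : ℕ} (hm : m ≠ 0) {n j : ℤ} (he : Even (n * j)) (N : ℤ) :
    reflX.sg (vertical (n * Real.pi / m)) (polW (((m : ℤ) * j) ^ 2) N) = polW (((m : ℤ) * j) ^ 2) N := by
  rw [LatticeIsometry.sg_def, reflX_act_polW]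
  apply TaylorGreenHat.fourierVelocity_ext
  funext k i
  rw [translate_coeff]
  by_cases h : k 2 ^ 2 = ((m : ℤ) * j) ^ 2 ∧ k 0 ^ 2 + k 1 ^ 2 = N
  · rw [phase_glide_of_even hm h.1 he, one_mul]
  · rw [polW_coeff_eq_zero h]; simp

/-- The glide `S_a`, `a = nπ/m`, fixes the poloidal witness on `K((mj)², N)` when `n j` is even. [folklore] -/
theorem reflZ_sg_polW {m : ℕ} (hm : m ≠ 0) {n j : ℤ} (he : Even (n * j)) (N : ℤ) :
    reflZ.sg (vertical (n * Real.pi / m)) (polW (((m : ℤ) * j) ^ 2) N) = polW (((m : ℤ) * j) ^ 2) N := by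
  rw [LatticeIsometry.sg_def, reflZ_act_polW]
  apply TaylorGreenHat.fourierVelocity_ext
  funext k i
  rw [translate_coeff]
  by_cases h : k 2 ^ 2 = ((m : ℤ) * j) ^ 2 ∧ k 0 ^ 2 + k 1 ^ 2 = N
  · rw [phase_glide_of_even hm h.1 he, one_mul]
  · rw [polW_coeff_eq_zero h]; simp

/-- Off the vertical axis `k₀² + k₁² ≠ 0`. [folklore] -/
theorem horiz_sq_ne_zero {k : Fin 3 → ℤ} (hoff : ¬ (k 0 = 0 ∧ k 1 = 0)) : k 0 ^ 2 + k 1 ^ 2 ≠ 0 := by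
  intro h
  have h0 : k 0 ^ 2 = 0 := by nlinarith [sq_nonneg (k 0), sq_nonneg (k 1)]
  have h1 : k 1 ^ 2 = 0 := by nlinarith [sq_nonneg (k 0), sq_nonneg (k 1)]
  exact hoff ⟨pow_eq_zero_iff (n := 2) (by norm_num) |>.mp h0, pow_eq_zero_iff (n := 2) (by norm_num) |>.mp h1⟩

/-- **Off the vertical axis and off the `z`-mean plane the poloidal witness does not vanish.** [folklore] -/
theorem polW_coeff_ne_zero {k : Fin 3 → ℤ} (hk2 : k 2 ≠ 0) (hoff : ¬ (k 0 = 0 ∧ k 1 = 0)) :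
    (polW (k 2 ^ 2) (k 0 ^ 2 + k 1 ^ 2)).coeff k ≠ 0 := by
  have hχ : chi (k 2 ^ 2) (k 0 ^ 2 + k 1 ^ 2) k = k 2 := chi_of_mem ⟨rfl, rfl⟩
  intro h
  have h2 : (polW (k 2 ^ 2) (k 0 ^ 2 + k 1 ^ 2)).coeff k 2 = 0 := by rw [h]; rfl
  rw [polW_coeff_two, hχ] at h2
  have hC : ((((k 0 ^ 2 + k 1 ^ 2) * k 2 : ℤ)) : ℂ) ≠ 0 := by
    exact_mod_cast mul_ne_zero (horiz_sq_ne_zero hoff) hk2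
  exact mul_ne_zero I_ne_zero hC h2

end Summit.NavierStokesRegularity.FluidComputer.ForcedModes

end
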